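/-
Origin: expansion seat `prover-pub-hodgecm-mc-carch-1-0`, handover #CA5 2026-08-19T23:12Z md5 b8e455a4ff75 (112 l.; NEW additive leaf; imports Model.ThetaSpaceInputPin, Model.Junction.LevelSaturation, Vendored.H21.NumberTheory.Automorphic.UnitaryGroupArchSection — all RUN-36 INSTALLED) (`HOME/mc/pub-hodgecm-mc-carch-1/pkg/HodgeCM/Model/ArchKTypeOfFix.lean`, md5 b8e455a4, 112 lines);
landed by the gen-13 packager (p-g13) in gate run 37 as `HodgeCM/Model/ArchKTypeOfFix.lean` (verbatim).
-/
/-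
Copyright (c) 2026. Released under Apache 2.0 license as described in the file LICENSE.
Cell pub-hodgecm, MODEL layer (construction prover mc-carch-1, gen 0), BINDER-OWNERS row 12 `C`, field (W-Kf′) `fixN` of the
honest-pin term `Model/ArchKTypeOf.archKTypeOf`: the junction `hfix` over the saturation group SPLITS into its compact-archimedean
factor (c5) and its finite-adelic factor (D-2).
-/
import Summits.HodgeConjecture.HodgeCM.Model.ThetaSpaceInputPin_2
import Summits.HodgeConjecture.HodgeCM.Model.Junction.LevelSaturation
import Literature.NumberTheory.Automorphic.UnitaryGroupArchSection

/-!
# `hfix` over `satLevelRegimeOf V hV K` = (away-from-`ι₁` archimedean part) ∧ (finite part in `K`)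

The (C-Kf∞)-correct finite `K`-type of `Model/ArchKTypeOf.archKTypeOf` is the saturation group
`satLevelRegimeOf V hV K = regimeEquiv '' (awayFromCM 3 L ι₁ V.Hm ⊓ cmSplitLevel L 3 V.Hm K)` (discharge-1
`Junction/LevelSaturation`): the elements of `U(V)(𝔸_{L⁺})` with TRIVIAL `ι₁`-component and finite part in `K`.  Every such
element is `(g_∞, 1_f) · (1_∞, g_f)` with `(g_∞)_{w(ι₁)} = 1` and `g_f ∈ K` (`UnitaryGroupAdelicProduct.archToAdelic_mul_finAdelicToAdelic`,
`UnitaryGroupArchSection.mem_awayFrom_iff`, `UnitaryGroupArchLatticeJunction.mem_cmSplitLevel_iff`), so the (W-Kf′) hypothesis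

  `hfix : ∀ x ∈ satLevelRegimeOf V hV K, ∀ ℓ, (S.P k).ω (x, 1) φ_N(Φ ℓ) = φ_N(Φ ℓ)`

of `archKTypeOf` follows from TWO hypotheses in the dischargers' own currencies (**`satLevel_fix_of_arch_of_fin`**):

* (c5) **`harch`** — every archimedean `a ∈ U(V.Hm)(L ⊗ ℝ)` with `a_{w(ι₁)} = 1` fixes `φ_N(Φ ℓ)`:
  `(S.P k).ω (regimeEquiv hV (archToAdelic a), 1) (testFun (Φ ℓ) x₀ N) = testFun (Φ ℓ) x₀ N` — the definite-place vacuum statement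
  (discharge-4 `HypCensus/DefiniteVacuumExponent.exists_exponent_twist_eq_self_of_signs` under (S-norm), once `Φ ℓ` is the vacuum
  at every `b ≠ ι₁` — `Model/ArchKTypeOfFrame.blockFamilyOf` with `Φ₂ :=` the Gaussian);
* (D-2) **`hfin`** — every `k_f ∈ K` fixes `φ_N(Φ_∞)` for EVERY archimedean `Φ_∞`:
  `(S.P k).ω (regimeEquiv hV (finAdelicToAdelic k_f), 1) (testFun Φ_∞ x₀ N) = testFun Φ_∞ x₀ N` — the deep-level fixing
  (mc-discharge-2 p189030 / p191419 / p191500, framed transport (F) `…SeesawCMLinesFramedDeepLevelFixed`, at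
  `K := finCongruenceLevel …` transported by the rational frame, `M` a multiple of the `n₀` there and of `N`).

Nothing is cited and nothing is minted: one kernel lemma (and its corollary with the roles named as in `archKTypeOf`).
-/

set_option autoImplicit false

noncomputable section

open NumberField NumberField.mixedEmbedding
open Literature.NumberTheory.Automorphic Literature.NumberTheory.Automorphic.UnitaryGroup
open Literature.AlgebraicGeometry.HodgeTheory Literature.NumberTheory.Automorphic.PicardCM
open HodgeCM.Model.SupplyInstance HodgeCM.Model.SupplyResidual
open scoped Classical SchwartzMap

namespace HodgeCM
namespace Model

section Fix

variable {L : CMField} {ι₁ : L →+* ℂ} {V : HermSpace3 L ι₁} {c : SeesawCtx L}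
  (S : ThetaAdelicSide V c) (hV : IsAnisotropic L V.Hm) (k : Fin 4) (N : ℕ)
  (K : Subgroup (UnitaryGroup.finAdelic (↥(maximalRealSubfield L)) L (IsCMField.complexConj L) 3 V.Hm))
  {ιℓ : Type*} (Φ : ιℓ → 𝓢((Fin 3 → mixedSpace (↥(maximalRealSubfield L))), ℂ))

/-- **`hfix` over the saturation group from its two factors**: if every archimedean element of `U(V.Hm)(L ⊗ ℝ)` away from
`ι₁` fixes the test functions `φ_N(Φ ℓ)` ((c5), `harch`) and every finite-adelic element of `K` fixes ALL level-`N` thin-coset test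
functions at `x₀` ((D-2), `hfin`), then every element of `satLevelRegimeOf V hV K` fixes `φ_N(Φ ℓ)`. -/
theorem satLevel_fix_of_arch_of_fin
    (harch : ∀ a : UnitaryGroup.arch (↥(maximalRealSubfield L)) L (IsCMField.complexConj L) 3 V.Hm,
      UnitaryGroup.archAt (↥(maximalRealSubfield L)) L (IsCMField.complexConj L) 3 V.Hm (UnitaryGroup.cmPlace (L : Type) ι₁)
          (NumberField.complexConj_smul_infinitePlace (L : Type) _) (IsCMField.complexConj_ne_one (L : Type)) a = 1 →
      ∀ ℓ, (S.P k).ω (HodgeCM.Adelic.regimeEquiv L V.Hm hV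
          (UnitaryGroup.archToAdelic (↥(maximalRealSubfield L)) L (IsCMField.complexConj L) 3 V.Hm a), 1)
        (testFun (↥(maximalRealSubfield L)) (Fin 3) (Φ ℓ) (S.P k).x₀ N) =
          testFun (↥(maximalRealSubfield L)) (Fin 3) (Φ ℓ) (S.P k).x₀ N)
    (hfin : ∀ kf : UnitaryGroup.finAdelic (↥(maximalRealSubfield L)) L (IsCMField.complexConj L) 3 V.Hm, kf ∈ K →
      ∀ Φinf : 𝓢((Fin 3 → mixedSpace (↥(maximalRealSubfield L))), ℂ),
        (S.P k).ω (HodgeCM.Adelic.regimeEquiv L V.Hm hV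
          (UnitaryGroup.finAdelicToAdelic (↥(maximalRealSubfield L)) L (IsCMField.complexConj L) 3 V.Hm kf), 1)
        (testFun (↥(maximalRealSubfield L)) (Fin 3) Φinf (S.P k).x₀ N) =
          testFun (↥(maximalRealSubfield L)) (Fin 3) Φinf (S.P k).x₀ N) :
    ∀ x : (V.latticeModel printFact_unitaryCompact_holds).G,
      x ∈ (satLevelRegimeOf V hV K : Subgroup (V.latticeModel printFact_unitaryCompact_holds).G) →
      ∀ ℓ, (S.P k).ω (x, 1) (testFun (↥(maximalRealSubfield L)) (Fin 3) (Φ ℓ) (S.P k).x₀ N) =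
        testFun (↥(maximalRealSubfield L)) (Fin 3) (Φ ℓ) (S.P k).x₀ N := by
  rintro _ ⟨g, hg, rfl⟩ ℓ
  have hg' : g ∈ satLevelOf V K := hg
  obtain ⟨hga, hgf⟩ := Subgroup.mem_inf.1 hg'
  -- `g = (g_∞, 1) · (1, g_f)` with `(g_∞)_{w(ι₁)} = 1` and `g_f ∈ K`
  have hsplit := UnitaryGroup.archToAdelic_mul_finAdelicToAdelic (↥(maximalRealSubfield L)) L (IsCMField.complexConj L) 3
    V.Hm g
  have ha : UnitaryGroup.archAt (↥(maximalRealSubfield L)) L (IsCMField.complexConj L) 3 V.Hm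
      (UnitaryGroup.cmPlace (L : Type) ι₁) (NumberField.complexConj_smul_infinitePlace (L : Type) _)
      (IsCMField.complexConj_ne_one (L : Type))
      (UnitaryGroup.archPart (↥(maximalRealSubfield L)) L (IsCMField.complexConj L) 3 V.Hm g) = 1 :=
    (UnitaryGroup.mem_awayFrom_iff (↥(maximalRealSubfield L)) L (IsCMField.complexConj L) 3 V.Hm
      (IsCMField.complexConj_ne_one (L : Type)) (NumberField.complexConj_smul_infinitePlace (L : Type))
      (UnitaryGroup.cmPlace (L : Type) ι₁) g).1 hga
  have hf : UnitaryGroup.finPart (↥(maximalRealSubfield L)) L (IsCMField.complexConj L) 3 V.Hm g ∈ K :=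
    (mem_cmSplitLevel_iff (L : Type) 3 V.Hm K g).1 hgf
  have hsplit' : (HodgeCM.Adelic.regimeEquiv L V.Hm hV).toMonoidHom g =
      HodgeCM.Adelic.regimeEquiv L V.Hm hV
          (UnitaryGroup.archToAdelic (↥(maximalRealSubfield L)) L (IsCMField.complexConj L) 3 V.Hm
            (UnitaryGroup.archPart (↥(maximalRealSubfield L)) L (IsCMField.complexConj L) 3 V.Hm g)) *
        HodgeCM.Adelic.regimeEquiv L V.Hm hV
          (UnitaryGroup.finAdelicToAdelic (↥(maximalRealSubfield L)) L (IsCMField.complexConj L) 3 V.Hm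
            (UnitaryGroup.finPart (↥(maximalRealSubfield L)) L (IsCMField.complexConj L) 3 V.Hm g)) := by
    rw [← map_mul]
    exact congrArg (HodgeCM.Adelic.regimeEquiv L V.Hm hV) hsplit.symm
  let ρ' : ↥(HodgeCM.Adelic.regimeSubgroup L V.Hm) →*
      Module.End ℂ ↥(piSchwartzBruhat (↥(maximalRealSubfield L)) (Fin 3)) :=
    (S.P k).ω.comp (MonoidHom.inl _ _)
  have e1 : ∀ x : ↥(HodgeCM.Adelic.regimeSubgroup L V.Hm), (S.P k).ω (x, 1) = ρ' x := fun _ => rfl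
  rw [e1, hsplit', map_mul ρ', Module.End.mul_apply, ← e1, ← e1, hfin _ hf, harch _ ha]

end Fix

end Model
end HodgeCM

end
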